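import Summits.CriticalPhenomena.SAWScalingLimit.Theses.SAWDevelopingMap

/-!
# Sketch — crux-ideate round 2, ideator 4, crux `SAWDevelopingMap.ObservableToSLE`
(stmt-CriticalPhenomena-10472)

First lemmas of the two idea cards (signatures over existing declarations; `sorry` allowed here,
the cards only require that they ELABORATE):

* card A `kesten-root-renewal`: `CutAt`, `levelEdges`, `cutLevel_factorisation` (exact renewal
  factorisation of the critical weight at a lattice level crossed exactly once) and the typed
  anchor `RootRenewalTightness` (the one open lattice input of the line, flat-up root form);
* card B `side-transport-identity`: `side_identity` (Lemma 1 summed against a vertex test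
  function: boundary mid-edge sum on one side = interior discrete-gradient pairing).
-/

noncomputable section

open scoped BigOperators Topology NNReal ENNReal Classical
open Filter Set MeasureTheory Metric
open Literature.Probability.LatticeModels (HexVertex hexGraph hexCenter Site)
open Literature.Probability.RandomPlanarGeometry
open Literature.Probability.RandomPlanarGeometry.SAW

namespace Summit.CriticalPhenomena.SAWScalingLimit.Cruxes.ObservableToSLE.Ideator4

/-! ## Card A — Kesten's first irreducible bridge at the root -/

/-- The row index of a honeycomb vertex (the coordinate pinned by the exact-rows clause
`m i δ ≤ v.1 1` of `HexObservableLimit`): vertices of row `r` have heights `(√3/2)(r + 1/3)`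
(type `0`) and `(√3/2)(r + 2/3)` (type `1`); the vertical edges join `(x - e₁, 1)` (row `r-1`) to
`(x, 0)` (row `r = x 1`) and cross the level `(√3/2)·r`. -/
def row (v : HexVertex) : ℤ := v.1 1

/-- `γ` is CUT at level `m`: its vertex list is a nonempty prefix strictly below row `m` followed
by a nonempty suffix in rows `≥ m` — i.e. exactly one edge of `γ` crosses the level `m`
(Kesten's bridge/renewal level; Alberts–Duminil-Copin's "bridge height"). -/
def CutAt {Λ : Finset HexVertex} {a b : Sym2 HexVertex} (m : ℤ) (γ : HexMidEdgeSAW Λ a b) : Prop :=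
  ∃ pre suf : List HexVertex, γ.verts = pre ++ suf ∧ pre ≠ [] ∧ suf ≠ [] ∧
    (∀ v ∈ pre, row v < m) ∧ (∀ v ∈ suf, m ≤ row v)

/-- The vertical mid-edges of `Λ` crossing the level `m`: `{(x - e₁, 1), (x, 0)}` with `x 1 = m`
and both endpoints in `Λ`. -/
def levelEdges (Λ : Finset HexVertex) (m : ℤ) : Finset (Sym2 HexVertex) :=
  (Λ.filter fun v => row v = m ∧ v.2 = 0 ∧ ((v.1 - Pi.single 1 1, (1 : Fin 2)) : HexVertex) ∈ Λ).image
    fun v => s(((v.1 - Pi.single 1 1, (1 : Fin 2)) : HexVertex), v)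

/-- **First lemma (card A): exact renewal factorisation at a cut level.**  For a source mid-edge
below the level and a target above it, the critical weight of the walks cut at level `m` is the
sum over the crossing edge `e` of (weight of walks `a → e` inside the rows `< m`) × (weight of
walks `e → b` inside the rows `≥ m`).  Bijection: split `verts` at the unique crossing; the two
pieces live in disjoint row sets, so concatenation is always self-avoiding (no interaction term —
this is what makes the post-cut law EXACTLY the pinned law of the super-level domain, rooted at a
FLOOR VERTEX of an exact half-lattice lid). Finite combinatorics, provable now. -/
theorem cutLevel_factorisation (Λ : Finset HexVertex) (a b : Sym2 HexVertex) (m : ℤ)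
    (ha : ∀ v ∈ a, row v < m) (hb : ∀ v ∈ b, m ≤ row v) :
    (∑ γ : HexMidEdgeSAW Λ a b, if CutAt m γ then hexCriticalFugacity ^ γ.length else 0) =
      ∑ e ∈ levelEdges Λ m,
        (∑ ι : HexMidEdgeSAW (Λ.filter fun v => row v < m) a e, hexCriticalFugacity ^ ι.length) *
        (∑ γ' : HexMidEdgeSAW (Λ.filter fun v => m ≤ row v) e b, hexCriticalFugacity ^ γ'.length) := by
  sorry

/-- A vertex of the canonical discretisation lies in the open root box of half-width `ε` below
row `m` (heights are compared through the embedded, rescaled centre). -/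
def InBox (δ : ℝ) (apt : ℂ) (ε : ℝ) (m : ℤ) (v : HexVertex) : Prop :=
  row v < m ∧ |((δ : ℂ) * hexCenter v).re - apt.re| < ε

/-- `γ` (a SAW of `Ω_δ`) has a LID CUT at row `m` over the root box: a nonempty prefix inside the
box, then it leaves through the LID (first vertex outside is in row `m`, above the box) and never
re-enters the box.  By the factorisation, conditionally on the prefix the remainder is exactly the
critical SAW of the admissible family `Ω_δ ∖ box` from a floor vertex of the exact lid. -/
def LidCut {Ω : Set ℂ} {δ : ℝ} {a b : HexVertex} (apt : ℂ) (ε : ℝ) (m : ℤ)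
    (γ : HexDomainSAW Ω δ a b) : Prop :=
  ∃ pre suf : List HexVertex, γ.walk.support = pre ++ suf ∧ pre ≠ [] ∧
    (∀ v ∈ pre, InBox δ apt ε m v) ∧ (∀ v ∈ suf, ¬ InBox δ apt ε m v) ∧
    (∀ v, suf.head? = some v → row v = m ∧ |((δ : ℂ) * hexCenter v).re - apt.re| < ε)

/-- **Anchor of card A (typed, OPEN): root renewal tightness, flat-up root form.**  For a
Dobrushin domain flat-up in the `ρ`-ball at its root and ANY endpoint approximation (interior,
pendant, `δ^{1/2}`-deep starts allowed), with probability `≥ 1 − θ` the critical walk has a lid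
cut over the root box of size `ε` at a level of height `≤ im(pt 0) + ε`, eventually in `δ`.
Continuum shadow: Alberts–Duminil-Copin 2010 Thm 1.2–1.3 (bridge heights of SLE(8/3) accumulate
at the root, dim 3/4); infinite-volume lattice shadow: Kesten's relation `Σ_irr x_c^{|ω|} = 1`.
Not a continuity event, hence not implied by Conjecture 1 (same status as HPAT). -/
def RootRenewalTightness : Prop :=
  ∀ (D : DobrushinDomain) (ρ : ℝ) (a b : ℝ → HexVertex), 0 < ρ →
    D.carrier ∩ ball (D.pt 0) ρ = {z : ℂ | (D.pt 0).im < z.im} ∩ ball (D.pt 0) ρ →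
    IsEmbEndpointApprox hexGraph hexCenter D a b →
    ∀ θ : ℝ, 0 < θ → ∃ ε : ℝ, 0 < ε ∧ ε < ρ ∧ ∀ᶠ δ : ℝ in 𝓝[>] 0,
      hexSAWLaw D.carrier δ (a δ) (b δ)
          {γ | ¬ ∃ m : ℤ, δ * (m : ℝ) * (Real.sqrt 3 / 2) ≤ (D.pt 0).im + ε ∧
              LidCut (D.pt 0) ε m γ} ≤ ENNReal.ofReal θ

/-! ## Card B — the side-transport identity -/

/-- **First lemma (card B): Lemma 1 integrated by parts against a vertex test function.**
`W` is any finite set containing all neighbours of `Λ`; `hL1` is DCS Lemma 1 at every vertex of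
`Λ` (summed over its neighbours; the tree proves it, `DuminilCopinSmirnov2012_lemma1_holds`).
Conclusion: the ψ-weighted sum of `(p − v_p) F(p)` over the BOUNDARY mid-edges equals `−½` of the
interior pairing of `F` with the discrete gradient of `ψ` (interior mid-edge = mean of the two
centres, so `(e − v) + (e − w) = 0`).  With `ψ` supported at ONE flat zigzag side this localises
to that side; the right-hand side is `(ℓ²δ²/2)(Σ ∂̄ψ F + Σ τ_e² ∂ψ F) + O(δ³)`. Finite algebra. -/
theorem side_identity (Λ W : Finset HexVertex) (hW : ∀ v ∈ Λ, ∀ w, hexGraph.Adj v w → w ∈ W)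
    (a : Sym2 HexVertex) (ψ : HexVertex → ℂ)
    (hL1 : ∀ v ∈ Λ, ∑ w ∈ W.filter (fun w => hexGraph.Adj v w),
      (hexMidpoint s(v, w) - hexCenter v) *
        hexParafermionicObservable Λ a hexCriticalFugacity (5 / 8) s(v, w) = 0) :
    (∑ v ∈ Λ, ∑ w ∈ (W \ Λ).filter (fun w => hexGraph.Adj v w),
        (hexMidpoint s(v, w) - hexCenter v) * ψ v *
          hexParafermionicObservable Λ a hexCriticalFugacity (5 / 8) s(v, w)) =
      -(1 / 2 : ℂ) * ∑ v ∈ Λ, ∑ w ∈ Λ.filter (fun w => hexGraph.Adj v w),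
        (hexMidpoint s(v, w) - hexCenter v) * (ψ v - ψ w) *
          hexParafermionicObservable Λ a hexCriticalFugacity (5 / 8) s(v, w) := by
  sorry

end Summit.CriticalPhenomena.SAWScalingLimit.Cruxes.ObservableToSLE.Ideator4
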